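import Mathlib
import Literature.Topology.Algebra.DenseSubgroupEquivariance
import Literature.LinearAlgebra.Matrix.SU2MovesLines
import HarnessLib

/-!
# No line field equivariant under a dense subgroup when the isotropy group moves lines

A topological group `G` acts continuously on a space `X` with surjective orbit maps (transitively), and on
`W`-valued "one-forms" `u : X → W` (`W` a complex normed space) through a cocycle of fibre maps
`A : G → X → (W →L[ℂ] W)`: the push-forward `γ ⋆ u` of a form is characterised by
`(γ ⋆ u)(γ • x) = A γ x (u x)` (model case: `X` a homogeneous complex manifold with trivialised cotangent bundle
`X × W`, `A γ x = (Dγₓ)^{-T}`, `γ ⋆ u = (γ⁻¹)^* u`).  Let `Δ ≤ G` be a DENSE subgroup (typical source: the rational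
points of an algebraic group, dense in the real points by real / weak approximation) and let `𝒰, 𝒰₁, 𝒰₂` be
non-zero `ℂ`-subspaces of continuous forms stable under push-forward by `Δ` (`DenseSubgroup.StableUnder`).

* `DenseSubgroup.exists_apply_ne_zero` — the forms of `𝒰` have NO common zero: the common zero set is closed and
  `Δ`-stable, and `Δ`-orbits are dense (`DenseSubgroup.dense_orbit_of_dense`);
* `DenseSubgroup.exists_wedge_ne_zero` — if some (hence every) fibre carries no line invariant under the isotropy
  group (`hiso : ∀ v ≠ 0, ∃ k, k • x₀ = x₀ ∧ A k x₀ v ∉ ℂv`), then some wedge `u₁(x) ∧ u₂(x)` (`uᵢ ∈ 𝒰ᵢ`) is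
  non-zero, i.e. `u₁ x, u₂ x` are linearly independent.  Otherwise all `2 × 2` minors of `𝒰₂` vanish, the lines
  `ℓₓ = ev_x(𝒰₂)` form a `Δ`-equivariant continuous line field, equivariance passes from the dense `Δ` to `G`
  by a closed-condition argument on pairs of vectors, and the isotropy group of `x₀` would fix the line `ℓ_{x₀}`;
* `DenseSubgroup.hiso_of_SU2` — the hypothesis `hiso` holds as soon as, after an identification of the fibre at
  `x₀` with `ℂ²`, the isotropy group acts through maps containing every element of `SU(2)` up to a non-zero
  scalar (`SU2Line.exists_SU2_moves_line_twisted`: `SU(2)` fixes no line of `ℂ²`).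

Holomorphy plays no role: continuity of the forms suffices throughout.  All statements are elementary point-set
topology and linear algebra of pairs. [folklore]

## Provenance

Staged by the pub-hodgecm formalisation cell (DAG-node prover #01 lineage) under the LEAN-IN-TREE rule; it
supersedes `section Core` and `section Transport` of the cell's standalone package file
`HodgeCM/PerL34/LineField.lean` (namespace `HodgeCM.PerL34.LineField` ↦ `Literature.Topology.Algebra.DenseSubgroup`,
same short names), whose `section Fibre` is `Literature/LinearAlgebra/Matrix/SU2MovesLines.lean` and whose
topological preliminaries are `Literature/Topology/Algebra/DenseSubgroupEquivariance.lean`.  In the cell the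
theorem is the abstract shell of a "line-field contradiction" on the complex `2`-ball (`G = U(2,1)`,
`X = 𝔹²`, `W = ℂ²`, isotropy `U(2) × U(1)` acting on the cotangent fibre by the standard representation twisted
by a character).

## Not here

The production of the dense subgroup (real approximation), the transitivity of the action, and the identification
of an isotropy representation with (a twist of) the standard representation of `U(2)` — these are hypotheses.
-/

set_option autoImplicit false

open Set
open scoped Topology

namespace Literature.Topology.Algebra

namespace DenseSubgroup

open Literature.LinearAlgebra.Matrix

section Core

variable {G X W : Type*} [TopologicalSpace G] [Group G]
  [TopologicalSpace X] [MulAction G X] [ContinuousSMul G X]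
  [NormedAddCommGroup W] [NormedSpace ℂ W]

/-- `Δ`-stability of a space `𝒰` of `W`-valued forms on `X` under push-forward through the fibre cocycle `A`:
for `γ ∈ Δ` and `u ∈ 𝒰` the form `γ ⋆ u`, characterised by `(γ ⋆ u)(γ • x) = A γ x (u x)`, lies in `𝒰`
(for a subgroup, pull-back stability and push-forward stability are the same thing). [folklore] -/
def StableUnder (Δ : Subgroup G) (A : G → X → (W →L[ℂ] W)) (𝒰 : Submodule ℂ (X → W)) : Prop :=
  ∀ γ : G, γ ∈ Δ → ∀ u ∈ 𝒰, ∃ u' ∈ 𝒰, ∀ x : X, u' (γ • x) = A γ x (u x)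

/-- **No common zero.**  The common zero set of a non-zero `Δ`-stable space of continuous forms is empty: it is
closed and `Δ`-stable, and `Δ`-orbits are dense (surjective orbit maps of `G`, `Δ` dense, the fibre maps `A γ x`
injective). [folklore] -/
theorem exists_apply_ne_zero (Δ : Subgroup G) (hΔ : Dense (Δ : Set G))
    (htrans : ∀ x : X, Function.Surjective fun g : G => g • x)
    (A : G → X → (W →L[ℂ] W)) (hAinj : ∀ g x, Function.Injective (A g x))
    (𝒰 : Submodule ℂ (X → W)) (hcont : ∀ u ∈ 𝒰, Continuous u) (hstab : StableUnder Δ A 𝒰)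
    (hne : 𝒰 ≠ ⊥) (x : X) : ∃ u ∈ 𝒰, u x ≠ 0 := by
  by_contra hx
  push Not at hx
  -- the common zero set
  set Z : Set X := {y : X | ∀ u ∈ 𝒰, u y = 0} with hZ
  have hZclosed : IsClosed Z := by
    have : Z = ⋂ u ∈ 𝒰, (fun y : X => u y) ⁻¹' {0} := by
      ext y; simp [hZ]
    rw [this]
    exact isClosed_biInter fun u hu => (isClosed_singleton.preimage (hcont u hu))
  have hZstab : ∀ γ : G, γ ∈ Δ → ∀ y ∈ Z, γ • y ∈ Z := by
    intro γ hγ y hy u hu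
    -- push `u` forward by `γ⁻¹ ∈ Δ`: `u' (γ⁻¹ • (γ • y)) = A γ⁻¹ (γ • y) (u (γ • y))`, and `u' y = 0`
    obtain ⟨u', hu', hu'eq⟩ := hstab γ⁻¹ (Δ.inv_mem hγ) u hu
    have h1 := hu'eq (γ • y)
    rw [inv_smul_smul, hy u' hu'] at h1
    exact hAinj _ _ (by rw [← h1, map_zero])
  have hxZ : x ∈ Z := hx
  -- the dense `Δ`-orbit of `x` lies in the closed set `Z`, so `Z = univ`
  have horb : (fun g : G => g • x) '' (Δ : Set G) ⊆ Z := by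
    rintro _ ⟨γ, hγ, rfl⟩; exact hZstab γ hγ x hxZ
  have hZuniv : Z = univ := by
    have hd := dense_orbit_of_dense (X := X) Δ hΔ x (htrans x)
    have : closure ((fun g : G => g • x) '' (Δ : Set G)) ⊆ Z := closure_minimal horb hZclosed
    rw [hd.closure_eq] at this
    exact eq_univ_of_univ_subset this
  apply hne
  rw [Submodule.eq_bot_iff]
  intro u hu
  funext y
  have hy : y ∈ Z := by rw [hZuniv]; exact mem_univ y
  exact hy u hu

/-- **The line-field contradiction.**  Let `Δ ≤ G` be dense, the action of `G` on `X` transitive, the fibre maps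
`A g x` injective and `g ↦ A g x₀ w` continuous, and suppose the isotropy group of `x₀` moves every line of the
fibre (`hiso`).  Then two non-zero `Δ`-stable spaces `𝒰₁, 𝒰₂` of continuous forms have a non-zero wedge
`u₁(x) ∧ u₂(x)`, i.e. `u₁ x, u₂ x` linearly independent for some `uᵢ ∈ 𝒰ᵢ` and some `x`. [folklore] -/
theorem exists_wedge_ne_zero (Δ : Subgroup G) (hΔ : Dense (Δ : Set G))
    (htrans : ∀ x : X, Function.Surjective fun g : G => g • x)
    (A : G → X → (W →L[ℂ] W)) (hAinj : ∀ g x, Function.Injective (A g x))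
    (x₀ : X) (hAcont : ∀ w : W, Continuous fun g : G => A g x₀ w)
    (hiso : ∀ v : W, v ≠ 0 → ∃ k : G, k • x₀ = x₀ ∧ LinearIndependent ℂ ![A k x₀ v, v])
    (𝒰₁ 𝒰₂ : Submodule ℂ (X → W))
    (hcont₁ : ∀ u ∈ 𝒰₁, Continuous u) (hcont₂ : ∀ u ∈ 𝒰₂, Continuous u)
    (hstab₁ : StableUnder Δ A 𝒰₁) (hstab₂ : StableUnder Δ A 𝒰₂)
    (hne₁ : 𝒰₁ ≠ ⊥) (hne₂ : 𝒰₂ ≠ ⊥) :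
    ∃ u₁ ∈ 𝒰₁, ∃ u₂ ∈ 𝒰₂, ∃ x : X, LinearIndependent ℂ ![u₁ x, u₂ x] := by
  by_contra H
  push Not at H
  -- Step 1: all `2 × 2` minors of `𝒰₂` vanish identically (every `u ∈ 𝒰₂` is pointwise on the line of a
  -- form `u₁ ∈ 𝒰₁` not vanishing at the point).
  have minors : ∀ x : X, ∀ u ∈ 𝒰₂, ∀ u' ∈ 𝒰₂, ¬ LinearIndependent ℂ ![u x, u' x] := by
    intro x u hu u' hu'
    obtain ⟨u₁, hu₁, hu₁x⟩ :=
      exists_apply_ne_zero Δ hΔ htrans A hAinj 𝒰₁ hcont₁ hstab₁ hne₁ x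
    exact SU2Line.not_linearIndependent_pair_of_mem_span
      (SU2Line.mem_span_of_not_linearIndependent (H u₁ hu₁ u hu x) hu₁x)
      (SU2Line.mem_span_of_not_linearIndependent (H u₁ hu₁ u' hu' x) hu₁x)
  -- Step 2: a `u₂` non-vanishing at `x₀`; the CLOSED condition "`A h x₀ v` and `u₂ (h • x₀)` dependent"
  -- holds on the dense subgroup `Δ` (equivariance of the line field `x ↦ ℂ u₂(x)`), hence on all of `G`.
  obtain ⟨u₂, hu₂, hv⟩ := exists_apply_ne_zero Δ hΔ htrans A hAinj 𝒰₂ hcont₂ hstab₂ hne₂ x₀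
  set v : W := u₂ x₀ with hvdef
  set F : G → (Fin 2 → W) := fun h => ![A h x₀ v, u₂ (h • x₀)] with hF
  have hFcont : Continuous F := by
    have h1 : Continuous fun h : G => A h x₀ v := hAcont v
    have h2 : Continuous fun h : G => u₂ (h • x₀) := (hcont₂ u₂ hu₂).comp (by fun_prop)
    exact h1.matrixVecCons (h2.matrixVecCons continuous_const)
  have hclosed : IsClosed {h : G | ¬ LinearIndependent ℂ (F h)} := by
    have : {h : G | ¬ LinearIndependent ℂ (F h)} = F ⁻¹' {f | LinearIndependent ℂ f}ᶜ := by
      ext h; simp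
    rw [this]
    exact (isOpen_setOf_linearIndependent.isClosed_compl).preimage hFcont
  have hΔsub : (Δ : Set G) ⊆ {h : G | ¬ LinearIndependent ℂ (F h)} := by
    intro γ hγ
    obtain ⟨u', hu', hu'eq⟩ := hstab₂ γ hγ u₂ hu₂
    have hFγ : F γ = ![u' (γ • x₀), u₂ (γ • x₀)] := by
      simp only [hF, hu'eq x₀, hvdef]
    rw [mem_setOf_eq, hFγ]
    exact minors (γ • x₀) u' hu' u₂ hu₂
  have hall : ∀ h : G, ¬ LinearIndependent ℂ (F h) := by
    intro h
    have : h ∈ closure (Δ : Set G) := by rw [hΔ.closure_eq]; exact mem_univ h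
    exact closure_minimal hΔsub hclosed this
  -- Step 3: the isotropy group of `x₀` then fixes the line `ℂ v` — contradiction with `hiso`.
  obtain ⟨k, hk, hli⟩ := hiso v hv
  apply hall k
  simp only [hF, hk]
  exact hli

end Core

section Transport

variable {G X W : Type*} [Group G] [MulAction G X]
  [NormedAddCommGroup W] [NormedSpace ℂ W]

/-- **The isotropy hypothesis of `exists_wedge_ne_zero` from the structure of the fibre.**  If, after identifying
the fibre `W` at `x₀` with `ℂ²` (`e`), the isotropy group of `x₀` acts through maps containing every `g ∈ SU(2)`
up to a non-zero scalar (model case: an isotropy group `U(2) × U(1)` acting by the standard representation of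
`U(2)` twisted by a character), then every non-zero vector of `W` is moved off its line by some element of the
isotropy group. [folklore] -/
theorem hiso_of_SU2 (A : G → X → (W →L[ℂ] W)) (x₀ : X) (e : W ≃ₗ[ℂ] (Fin 2 → ℂ))
    (hK : ∀ g ∈ Matrix.specialUnitaryGroup (Fin 2) ℂ,
      ∃ k : G, k • x₀ = x₀ ∧ ∃ c : ℂ, c ≠ 0 ∧ ∀ w : W, e (A k x₀ w) = c • (Matrix.mulVec g (e w))) :
    ∀ v : W, v ≠ 0 → ∃ k : G, k • x₀ = x₀ ∧ LinearIndependent ℂ ![A k x₀ v, v] := by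
  intro v hv
  have hv' : e v ≠ 0 := by
    intro h; exact hv (e.map_eq_zero_iff.mp h)
  obtain ⟨g, hg, hli⟩ := SU2Line.exists_SU2_moves_line_twisted (e v) hv'
  obtain ⟨k, hk, c, hc, hcw⟩ := hK g hg
  refine ⟨k, hk, ?_⟩
  have key : LinearIndependent ℂ (e ∘ ![A k x₀ v, v]) := by
    have : (e ∘ ![A k x₀ v, v]) = ![c • (Matrix.mulVec g (e v)), e v] := by
      funext i; fin_cases i <;> simp [hcw]
    rw [this]; exact hli c hc
  exact key.of_comp e.toLinearMap

end Transport

section Assembled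

variable {G X W : Type*} [TopologicalSpace G] [Group G]
  [TopologicalSpace X] [MulAction G X] [ContinuousSMul G X]
  [NormedAddCommGroup W] [NormedSpace ℂ W]

/-- **The line-field contradiction with the `SU(2)` fibre hypothesis** (`exists_wedge_ne_zero` ∘ `hiso_of_SU2`):
dense `Δ`, transitive action, injective fibre maps continuous in the group variable at `x₀`, an isotropy
representation at `x₀` containing `SU(2)` up to scalars after identifying the fibre with `ℂ²`, and two non-zero
`Δ`-stable spaces of continuous forms give a non-zero wedge `u₁(x) ∧ u₂(x)`. [folklore] -/
theorem exists_wedge_ne_zero_of_SU2 (Δ : Subgroup G) (hΔ : Dense (Δ : Set G))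
    (htrans : ∀ x : X, Function.Surjective fun g : G => g • x)
    (A : G → X → (W →L[ℂ] W)) (hAinj : ∀ g x, Function.Injective (A g x))
    (x₀ : X) (hAcont : ∀ w : W, Continuous fun g : G => A g x₀ w)
    (e : W ≃ₗ[ℂ] (Fin 2 → ℂ))
    (hK : ∀ g ∈ Matrix.specialUnitaryGroup (Fin 2) ℂ,
      ∃ k : G, k • x₀ = x₀ ∧ ∃ c : ℂ, c ≠ 0 ∧ ∀ w : W, e (A k x₀ w) = c • (Matrix.mulVec g (e w)))
    (𝒰₁ 𝒰₂ : Submodule ℂ (X → W))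
    (hcont₁ : ∀ u ∈ 𝒰₁, Continuous u) (hcont₂ : ∀ u ∈ 𝒰₂, Continuous u)
    (hstab₁ : StableUnder Δ A 𝒰₁) (hstab₂ : StableUnder Δ A 𝒰₂)
    (hne₁ : 𝒰₁ ≠ ⊥) (hne₂ : 𝒰₂ ≠ ⊥) :
    ∃ u₁ ∈ 𝒰₁, ∃ u₂ ∈ 𝒰₂, ∃ x : X, LinearIndependent ℂ ![u₁ x, u₂ x] :=
  exists_wedge_ne_zero Δ hΔ htrans A hAinj x₀ hAcont (hiso_of_SU2 A x₀ e hK)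
    𝒰₁ 𝒰₂ hcont₁ hcont₂ hstab₁ hstab₂ hne₁ hne₂

end Assembled

end DenseSubgroup

end Literature.Topology.Algebra
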